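import Summits.ResolutionOfSingularities.ResolutionOfSingularities.Theorems.WeightedInvariantWeightedConstructionHullUscToolkit
import Mathlib.AlgebraicGeometry.Morphisms.Finite
import Mathlib.AlgebraicGeometry.Morphisms.FiniteType
import Mathlib.Topology.JacobsonSpace
import HarnessLib

/-!
# Crux `WeightedConstruction`, line `pointwise-lexmax-hull`: stub `stub_hullUsc`, the generic-value layer

Route `ResolutionOfSingularities/WeightedInvariant`, crux `WeightedConstruction`
(stmt-ResolutionOfSingularities-0571), line `pointwise-lexmax-hull`, registered stub `stub_hullUsc`
(`R.USC ∧ R.HullComap ∧ R.HullBaseChange` for every `R : LexmaxHullRule p`). [OURS · L1 w43]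

The toolkit file (`…HullUscToolkit.lean`, p459633) reduced the three clauses from the HULL to the
GENERIC VALUE `gen` (field `gen_spec` of the rule: `gen η` is the value of the pointwise invariant `plex`
at the closed points of an open part `W ∋ η` of `closure {η}`). This file reduces `gen` to `plex`, i.e.
to statements about the pointwise invariant at CLOSED points only, using that schemes locally of
finite type over a field are Jacobson (closed points are dense in every locally closed subset,
`LocallyOfFiniteType.jacobsonSpace`, `nonempty_inter_closedPoints`):

* `genericValue_eq_of_specializes` — `gen` is constant along the stratum: `gen y = gen η` for every
  (singular) `y ∈ W`, `η ⤳ y`, closed or not.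
* `genericValue_eq_gen_of_const` — if `plex` is constant on the closed points of `W ∩ closure {η}` then
  that constant is `gen η`.
* `genericValue_eq_of_continuous` — along a continuous map `g : Y₁ → Y` of Jacobson spaces under which
  the (closed) singular loci correspond, `gen₁ η₁ = gen (g η₁)` as soon as
  `plex₁ y₁ = gen (g y₁)` at CLOSED `y₁` (the image `g y₁` need not be closed — ground-field base change);
  `genericValue_eq_of_continuous_of_closedPoints` — when `g` maps closed points to closed points
  (morphisms locally of finite type, `Scheme.Hom.closePoints_subset_preimage_closedPoints`) the
  hypothesis is plain pointwise invariance `plex₁ y₁ = plex (g y₁)` at closed points.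
* `genDominating_of_plexStrata` — a finite family of strata `W η₀ ∩ closure {η₀}` (`η₀ ∈ F`) covering the
  singular locus, on whose closed points `plex` is constant, is a `gen`-dominating family
  (`gen η = gen η₀`), the input of `isClosed_genHull_superlevel_of_finite`.
* Scheme forms with the skeleton's `XSing`: `gen_comap_eq_of_smooth_of_plex`,
  `gen_comap_eq_of_isPullback_of_plex`, `isClosed_superlevel_genHull_xSing_of_plexStrata`, and the
  end-to-end forms `genHull_comap_eq_of_smooth_of_plex`, `genHull_comap_eq_of_isPullback_of_plex`.

Net effect (census in L/res-L1-w43-stub-2/NOTES.md): `stub_hullUsc` ⇐ three statements about `plex`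
at closed singular points — (B1') finite `plex`-constant stratification of the singular locus,
(B2') `plex (X.comap g) y₁ = plex X (g y₁)` for smooth `g`, (B3') `plex (X.comap pr) y₁ = gen X (pr y₁)`
for a perfect ground-field extension. No new mathematics; NOT a statement of the manuscript under review.
-/

set_option linter.dupNamespace false -- mandated namespace of this single-conjunct summit

open CategoryTheory CategoryTheory.Limits AlgebraicGeometry TopologicalSpace Topology

namespace Summit.ResolutionOfSingularities.ResolutionOfSingularities.Theorems

universe u v w

section Topology

variable {Y : Type v} [TopologicalSpace Y] {α : Type w}

/-- **The generic value is constant along its stratum.** If `gen η` is the value of `plex` at the closed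
points `y' ∈ W` with `η ⤳ y'` (some open `W ∋ η`, for every singular `η`), then for every singular
`y ∈ W` with `η ⤳ y` — closed or not — `gen y = gen η`: the locally closed set
`W ∩ W_y ∩ closure {y}` contains a closed point (Jacobson), at which `plex` equals both. [folklore] -/
theorem genericValue_eq_of_specializes [JacobsonSpace Y] {S : Y → Prop} {plex gen : Y → α}
    (hgen : ∀ η, S η → ∃ W : Opens Y, η ∈ W ∧
      ∀ y, y ∈ W → η ⤳ y → IsClosed ({y} : Set Y) → plex y = gen η)
    {η y : Y} {W : Opens Y}
    (hW : ∀ y', y' ∈ W → η ⤳ y' → IsClosed ({y'} : Set Y) → plex y' = gen η)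
    (hy : S y) (hyW : y ∈ W) (hηy : η ⤳ y) : gen y = gen η := by
  obtain ⟨W', hyW', hW'⟩ := hgen y hy
  have hlc : IsLocallyClosed (((W : Set Y) ∩ (W' : Set Y)) ∩ closure {y}) :=
    (W.isOpen.inter W'.isOpen).isLocallyClosed.inter isClosed_closure.isLocallyClosed
  obtain ⟨z, ⟨⟨hzW, hzW'⟩, hzy⟩, hzcl⟩ :=
    nonempty_inter_closedPoints (Z := ((W : Set Y) ∩ (W' : Set Y)) ∩ closure {y})
      ⟨y, ⟨hyW, hyW'⟩, subset_closure rfl⟩ hlc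
  have hyz : y ⤳ z := specializes_iff_mem_closure.mpr hzy
  rw [← hW' z hzW' hyz hzcl]
  exact hW z hzW (hηy.trans hyz) hzcl

/-- **A constant value of `plex` on a stratum is the generic value.** If `plex` takes one and the same
value at all closed `y ∈ W` with `η ⤳ y`, that value is `gen η` (compare at a closed point of
`W ∩ W_η ∩ closure {η}`, which exists by the Jacobson property). [folklore] -/
theorem genericValue_eq_gen_of_const [JacobsonSpace Y] {S : Y → Prop} {plex gen : Y → α}
    (hgen : ∀ η, S η → ∃ W : Opens Y, η ∈ W ∧
      ∀ y, y ∈ W → η ⤳ y → IsClosed ({y} : Set Y) → plex y = gen η)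
    {η : Y} (hη : S η) {W : Opens Y} (hηW : η ∈ W)
    (hconst : ∀ y y', y ∈ W → y' ∈ W → η ⤳ y → η ⤳ y' → IsClosed ({y} : Set Y) →
      IsClosed ({y'} : Set Y) → plex y = plex y')
    {y : Y} (hyW : y ∈ W) (hηy : η ⤳ y) (hycl : IsClosed ({y} : Set Y)) : plex y = gen η := by
  obtain ⟨W', hηW', hW'⟩ := hgen η hη
  have hlc : IsLocallyClosed (((W : Set Y) ∩ (W' : Set Y)) ∩ closure {η}) :=
    (W.isOpen.inter W'.isOpen).isLocallyClosed.inter isClosed_closure.isLocallyClosed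
  obtain ⟨z, ⟨⟨hzW, hzW'⟩, hzη⟩, hzcl⟩ :=
    nonempty_inter_closedPoints (Z := ((W : Set Y) ∩ (W' : Set Y)) ∩ closure {η})
      ⟨η, ⟨hηW, hηW'⟩, subset_closure rfl⟩ hlc
  have hηz : η ⤳ z := specializes_iff_mem_closure.mpr hzη
  rw [hconst y z hyW hzW hηy hηz hycl hzcl]
  exact hW' z hzW' hηz hzcl

/-- **Generic values agree along a continuous map of Jacobson spaces.** Let `g : Y₁ → Y` be continuous,
the singular locus `S` of `Y` closed with preimage the singular locus `S₁` of `Y₁`, and `gen`, `gen₁`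
generic values of `plex`, `plex₁` as in `gen_spec`. If at every CLOSED singular `y₁` the pointwise value
upstairs is the generic value downstairs, `plex₁ y₁ = gen (g y₁)` (the point `g y₁` need not be
closed), then `gen₁ η₁ = gen (g η₁)` at every singular `η₁`. [folklore] -/
theorem genericValue_eq_of_continuous [JacobsonSpace Y] {Y₁ : Type u} [TopologicalSpace Y₁]
    [JacobsonSpace Y₁] {g : Y₁ → Y} (hg : Continuous g)
    {S : Y → Prop} (hS : IsClosed {y | S y}) {S₁ : Y₁ → Prop} (hS₁ : ∀ y₁, S₁ y₁ ↔ S (g y₁))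
    {plex gen : Y → α} {plex₁ gen₁ : Y₁ → α}
    (hgen : ∀ η, S η → ∃ W : Opens Y, η ∈ W ∧
      ∀ y, y ∈ W → η ⤳ y → IsClosed ({y} : Set Y) → plex y = gen η)
    (hgen₁ : ∀ η₁, S₁ η₁ → ∃ W₁ : Opens Y₁, η₁ ∈ W₁ ∧
      ∀ y₁, y₁ ∈ W₁ → η₁ ⤳ y₁ → IsClosed ({y₁} : Set Y₁) → plex₁ y₁ = gen₁ η₁)
    (hplex : ∀ y₁, IsClosed ({y₁} : Set Y₁) → S (g y₁) → plex₁ y₁ = gen (g y₁))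
    {η₁ : Y₁} (hη : S (g η₁)) : gen₁ η₁ = gen (g η₁) := by
  obtain ⟨W₁, hηW₁, hW₁⟩ := hgen₁ η₁ ((hS₁ η₁).mpr hη)
  obtain ⟨W, hηW, hW⟩ := hgen (g η₁) hη
  have hlc : IsLocallyClosed ((((W₁ : Set Y₁)) ∩ g ⁻¹' (W : Set Y)) ∩ closure {η₁}) :=
    (W₁.isOpen.inter (W.isOpen.preimage hg)).isLocallyClosed.inter isClosed_closure.isLocallyClosed
  obtain ⟨y₁, ⟨⟨hy₁W₁, hy₁W⟩, hy₁η⟩, hy₁cl⟩ :=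
    nonempty_inter_closedPoints (Z := (((W₁ : Set Y₁)) ∩ g ⁻¹' (W : Set Y)) ∩ closure {η₁})
      ⟨η₁, ⟨hηW₁, hηW⟩, subset_closure rfl⟩ hlc
  have hηy₁ : η₁ ⤳ y₁ := specializes_iff_mem_closure.mpr hy₁η
  have hgηy : g η₁ ⤳ g y₁ := hηy₁.map hg
  have hSgy : S (g y₁) := hgηy.mem_closed hS hη
  rw [← hW₁ y₁ hy₁W₁ hηy₁ hy₁cl, hplex y₁ hy₁cl hSgy]
  exact genericValue_eq_of_specializes hgen hW hSgy hy₁W hgηy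

/-- **Generic values agree along a continuous map preserving closed points.** As
`genericValue_eq_of_continuous`, for `g` mapping closed points to closed points; the hypothesis is then
plain pointwise invariance `plex₁ y₁ = plex (g y₁)` at closed singular points. [folklore] -/
theorem genericValue_eq_of_continuous_of_closedPoints [JacobsonSpace Y] {Y₁ : Type u}
    [TopologicalSpace Y₁] [JacobsonSpace Y₁] {g : Y₁ → Y} (hg : Continuous g)
    (hgcl : ∀ y₁, IsClosed ({y₁} : Set Y₁) → IsClosed ({g y₁} : Set Y))
    {S : Y → Prop} (hS : IsClosed {y | S y}) {S₁ : Y₁ → Prop} (hS₁ : ∀ y₁, S₁ y₁ ↔ S (g y₁))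
    {plex gen : Y → α} {plex₁ gen₁ : Y₁ → α}
    (hgen : ∀ η, S η → ∃ W : Opens Y, η ∈ W ∧
      ∀ y, y ∈ W → η ⤳ y → IsClosed ({y} : Set Y) → plex y = gen η)
    (hgen₁ : ∀ η₁, S₁ η₁ → ∃ W₁ : Opens Y₁, η₁ ∈ W₁ ∧
      ∀ y₁, y₁ ∈ W₁ → η₁ ⤳ y₁ → IsClosed ({y₁} : Set Y₁) → plex₁ y₁ = gen₁ η₁)
    (hplex : ∀ y₁, IsClosed ({y₁} : Set Y₁) → S (g y₁) → plex₁ y₁ = plex (g y₁))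
    {η₁ : Y₁} (hη : S (g η₁)) : gen₁ η₁ = gen (g η₁) := by
  refine genericValue_eq_of_continuous hg hS hS₁ hgen hgen₁ (fun y₁ hy₁ hSy => ?_) hη
  obtain ⟨W, hyW, hW⟩ := hgen (g y₁) hSy
  rw [hplex y₁ hy₁ hSy]
  exact hW (g y₁) hyW specializes_rfl (hgcl y₁ hy₁)

/-- **A finite `plex`-constant stratification dominates `gen`.** If strata `W η₀ ∩ closure {η₀}`
(`η₀ ∈ F` singular) cover the singular locus and `plex` has the constant value `gen η₀` at the closed
points of the stratum of `η₀`, then every singular `η` specialises from some `η₀ ∈ F` with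
`gen η = gen η₀` — the `gen`-dominating family required by `isClosed_genHull_superlevel_of_finite`.
[folklore] -/
theorem genDominating_of_plexStrata [JacobsonSpace Y] {S : Y → Prop} {plex gen : Y → α}
    (hgen : ∀ η, S η → ∃ W : Opens Y, η ∈ W ∧
      ∀ y, y ∈ W → η ⤳ y → IsClosed ({y} : Set Y) → plex y = gen η)
    {F : Set Y} (W : Y → Opens Y)
    (hcover : ∀ η, S η → ∃ η₀ ∈ F, η₀ ⤳ η ∧ η ∈ W η₀)
    (hval : ∀ η₀ ∈ F, ∀ y, y ∈ W η₀ → η₀ ⤳ y → IsClosed ({y} : Set Y) → plex y = gen η₀)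
    {η : Y} (hη : S η) : ∃ η₀ ∈ F, η₀ ⤳ η ∧ gen η = gen η₀ := by
  obtain ⟨η₀, hη₀F, hη₀η, hηW⟩ := hcover η hη
  exact ⟨η₀, hη₀F, hη₀η, genericValue_eq_of_specializes hgen (hval η₀ hη₀F) hη hηW hη₀η⟩

end Topology

/-! ## Scheme-level forms with the skeleton's singular locus `XSing` -/

/-- **(B2') ⇒ `GenComap`.** For a smooth `k`-morphism `g : Y₁ → Y` of schemes locally of finite type over
a field (Jacobson; `g` maps closed points to closed points), if the pointwise invariant is `g`-invariant
at CLOSED singular points, `plex₁ y₁ = plex (g y₁)`, then so is the generic value at all singular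
points: `gen₁ η₁ = gen (g η₁)`. [folklore] -/
theorem gen_comap_eq_of_smooth_of_plex {α : Type w} ⦃k : Type⦄ [Field k] ⦃Y Y₁ : Scheme.{0}⦄
    (f : Y ⟶ Spec (.of k)) [LocallyOfFiniteType f] (f₁ : Y₁ ⟶ Spec (.of k)) [LocallyOfFiniteType f₁]
    (g : Y₁ ⟶ Y) [Smooth g] (hg : g ≫ f = f₁) (X : Y.IdealSheafData)
    {plex gen : Y → α} {plex₁ gen₁ : Y₁ → α}
    (hgen : ∀ η : Y, (∃ x : X.subscheme, X.subschemeι x = η ∧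
        ¬ IsRegularLocalRing (X.subscheme.presheaf.stalk x)) →
      ∃ W : Y.Opens, η ∈ W ∧ ∀ y : Y, y ∈ W → η ⤳ y → IsClosed ({y} : Set Y) → plex y = gen η)
    (hgen₁ : ∀ η₁ : Y₁, (∃ x₁ : (X.comap g).subscheme, (X.comap g).subschemeι x₁ = η₁ ∧
        ¬ IsRegularLocalRing ((X.comap g).subscheme.presheaf.stalk x₁)) →
      ∃ W₁ : Y₁.Opens, η₁ ∈ W₁ ∧
        ∀ y₁ : Y₁, y₁ ∈ W₁ → η₁ ⤳ y₁ → IsClosed ({y₁} : Set Y₁) → plex₁ y₁ = gen₁ η₁)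
    (hplex : ∀ y₁ : Y₁, IsClosed ({y₁} : Set Y₁) → (∃ x : X.subscheme, X.subschemeι x = g y₁ ∧
        ¬ IsRegularLocalRing (X.subscheme.presheaf.stalk x)) → plex₁ y₁ = plex (g y₁))
    (η₁ : Y₁) (hη : ∃ x : X.subscheme, X.subschemeι x = g η₁ ∧
      ¬ IsRegularLocalRing (X.subscheme.presheaf.stalk x)) :
    gen₁ η₁ = gen (g η₁) := by
  haveI : JacobsonSpace Y := LocallyOfFiniteType.jacobsonSpace f
  haveI : JacobsonSpace Y₁ := LocallyOfFiniteType.jacobsonSpace f₁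
  haveI : LocallyOfFiniteType (g ≫ f) := by rw [hg]; infer_instance
  haveI : LocallyOfFiniteType g := locallyOfFiniteType_of_comp g f
  have hgcl : ∀ y₁ : Y₁, IsClosed ({y₁} : Set Y₁) → IsClosed ({g y₁} : Set Y) :=
    fun y₁ hy₁ => g.closePoints_subset_preimage_closedPoints hy₁
  exact genericValue_eq_of_continuous_of_closedPoints g.continuous hgcl
    (stub_isClosed_singularLocus f X) (fun y₁ => xSing_comap_iff_of_smooth f f₁ g hg X y₁)
    hgen hgen₁ hplex hη

/-- **(B3') ⇒ `GenBaseChange`.** For a cartesian square `pr : YK = Y ×_k K → Y` over a homomorphism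
`φ : k → K` of perfect fields, `Y` locally of finite type over `k` (so `YK` is locally of finite type
over `K`; both Jacobson): if at every CLOSED singular point `y₁` of `YK` the pointwise invariant equals the
generic value at the (possibly non-closed) point `pr y₁`, `plex₁ y₁ = gen (pr y₁)`, then
`gen₁ η₁ = gen (pr η₁)` at all singular points. [folklore] -/
theorem gen_comap_eq_of_isPullback_of_plex {α : Type w} ⦃k : Type⦄ [Field k] [PerfectField k]
    ⦃K : Type⦄ [Field K] [PerfectField K] (φ : k →+* K) ⦃Y YK : Scheme.{0}⦄
    (f : Y ⟶ Spec (.of k)) [LocallyOfFiniteType f] (fK : YK ⟶ Spec (.of K)) (pr : YK ⟶ Y)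
    (hpb : IsPullback pr fK f (Spec.map (CommRingCat.ofHom φ))) (X : Y.IdealSheafData)
    {plex gen : Y → α} {plex₁ gen₁ : YK → α}
    (hgen : ∀ η : Y, (∃ x : X.subscheme, X.subschemeι x = η ∧
        ¬ IsRegularLocalRing (X.subscheme.presheaf.stalk x)) →
      ∃ W : Y.Opens, η ∈ W ∧ ∀ y : Y, y ∈ W → η ⤳ y → IsClosed ({y} : Set Y) → plex y = gen η)
    (hgen₁ : ∀ η₁ : YK, (∃ x₁ : (X.comap pr).subscheme, (X.comap pr).subschemeι x₁ = η₁ ∧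
        ¬ IsRegularLocalRing ((X.comap pr).subscheme.presheaf.stalk x₁)) →
      ∃ W₁ : YK.Opens, η₁ ∈ W₁ ∧
        ∀ y₁ : YK, y₁ ∈ W₁ → η₁ ⤳ y₁ → IsClosed ({y₁} : Set YK) → plex₁ y₁ = gen₁ η₁)
    (hplex : ∀ y₁ : YK, IsClosed ({y₁} : Set YK) → (∃ x : X.subscheme, X.subschemeι x = pr y₁ ∧
        ¬ IsRegularLocalRing (X.subscheme.presheaf.stalk x)) → plex₁ y₁ = gen (pr y₁))
    (η₁ : YK) (hη : ∃ x : X.subscheme, X.subschemeι x = pr η₁ ∧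
      ¬ IsRegularLocalRing (X.subscheme.presheaf.stalk x)) :
    gen₁ η₁ = gen (pr η₁) := by
  haveI : JacobsonSpace Y := LocallyOfFiniteType.jacobsonSpace f
  haveI : LocallyOfFiniteType fK :=
    MorphismProperty.IsStableUnderBaseChange.of_isPullback (P := @LocallyOfFiniteType) hpb
      ‹LocallyOfFiniteType f›
  haveI : JacobsonSpace YK := LocallyOfFiniteType.jacobsonSpace fK
  exact genericValue_eq_of_continuous pr.continuous (stub_isClosed_singularLocus f X)
    (fun y₁ => xSing_comap_iff_of_isPullback_perfectField φ f fK pr hpb X y₁) hgen hgen₁ hplex hη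

/-- **(B1') ⇒ `(usc)`.** For `Y` locally of finite type over a field, an ideal sheaf `X`, a pointwise
invariant `plex` with generic values `gen` (`gen_spec`) and hull `hull` (`hull_isGreatest`) on the
singular locus: a FINITE family of strata `W η₀ ∩ closure {η₀}` (`η₀` singular) covering the singular
locus, with `plex` constant (`= gen η₀`) on the closed points of each stratum, makes every superlevel
set `{y singular | γ ≤ hull y}` closed. [folklore] -/
theorem isClosed_superlevel_genHull_xSing_of_plexStrata {α : Type w} [Preorder α] ⦃k : Type⦄
    [Field k] ⦃Y : Scheme.{0}⦄ (f : Y ⟶ Spec (.of k)) [LocallyOfFiniteType f] (X : Y.IdealSheafData)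
    {plex gen hull : Y → α}
    (hgen : ∀ η : Y, (∃ x : X.subscheme, X.subschemeι x = η ∧
        ¬ IsRegularLocalRing (X.subscheme.presheaf.stalk x)) →
      ∃ W : Y.Opens, η ∈ W ∧ ∀ y : Y, y ∈ W → η ⤳ y → IsClosed ({y} : Set Y) → plex y = gen η)
    (hhull : ∀ y : Y, (∃ x : X.subscheme, X.subschemeι x = y ∧
        ¬ IsRegularLocalRing (X.subscheme.presheaf.stalk x)) →
      IsGreatest {π | ∃ η : Y, η ⤳ y ∧ (∃ x : X.subscheme, X.subschemeι x = η ∧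
        ¬ IsRegularLocalRing (X.subscheme.presheaf.stalk x)) ∧ π = gen η} (hull y))
    {F : Set Y} (hfin : F.Finite)
    (hFS : ∀ η₀ ∈ F, ∃ x : X.subscheme, X.subschemeι x = η₀ ∧
      ¬ IsRegularLocalRing (X.subscheme.presheaf.stalk x))
    (W : Y → Y.Opens)
    (hcover : ∀ η : Y, (∃ x : X.subscheme, X.subschemeι x = η ∧
        ¬ IsRegularLocalRing (X.subscheme.presheaf.stalk x)) → ∃ η₀ ∈ F, η₀ ⤳ η ∧ η ∈ W η₀)
    (hval : ∀ η₀ ∈ F, ∀ y : Y, y ∈ W η₀ → η₀ ⤳ y → IsClosed ({y} : Set Y) → plex y = gen η₀)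
    (γ : α) :
    IsClosed {y : Y | (∃ x : X.subscheme, X.subschemeι x = y ∧
      ¬ IsRegularLocalRing (X.subscheme.presheaf.stalk x)) ∧ γ ≤ hull y} := by
  haveI : JacobsonSpace Y := LocallyOfFiniteType.jacobsonSpace f
  refine isClosed_superlevel_genHull_xSing f X hhull hfin hFS (fun η hη => ?_) γ
  obtain ⟨η₀, hη₀F, hη₀η, heq⟩ := genDominating_of_plexStrata hgen W hcover hval hη
  exact ⟨η₀, hη₀F, hη₀η, heq.le⟩

/-- **(B2') ⇒ `HullComap`, end to end.** Smooth `k`-morphism `g : Y₁ → Y`, pointwise invariance of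
`plex` at closed singular points ⇒ the hulls agree at all singular points
(`gen_comap_eq_of_smooth_of_plex` + `genHull_comap_eq_of_smooth`). [folklore] -/
theorem genHull_comap_eq_of_smooth_of_plex {α : Type w} [PartialOrder α] ⦃k : Type⦄ [Field k]
    ⦃Y Y₁ : Scheme.{0}⦄ (f : Y ⟶ Spec (.of k)) [LocallyOfFiniteType f] (f₁ : Y₁ ⟶ Spec (.of k))
    [LocallyOfFiniteType f₁] (g : Y₁ ⟶ Y) [Smooth g] (hg : g ≫ f = f₁) (X : Y.IdealSheafData)
    {plex gen hull : Y → α} {plex₁ gen₁ hull₁ : Y₁ → α}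
    (hgen : ∀ η : Y, (∃ x : X.subscheme, X.subschemeι x = η ∧
        ¬ IsRegularLocalRing (X.subscheme.presheaf.stalk x)) →
      ∃ W : Y.Opens, η ∈ W ∧ ∀ y : Y, y ∈ W → η ⤳ y → IsClosed ({y} : Set Y) → plex y = gen η)
    (hgen₁ : ∀ η₁ : Y₁, (∃ x₁ : (X.comap g).subscheme, (X.comap g).subschemeι x₁ = η₁ ∧
        ¬ IsRegularLocalRing ((X.comap g).subscheme.presheaf.stalk x₁)) →
      ∃ W₁ : Y₁.Opens, η₁ ∈ W₁ ∧
        ∀ y₁ : Y₁, y₁ ∈ W₁ → η₁ ⤳ y₁ → IsClosed ({y₁} : Set Y₁) → plex₁ y₁ = gen₁ η₁)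
    (hhull : ∀ y : Y, (∃ x : X.subscheme, X.subschemeι x = y ∧
        ¬ IsRegularLocalRing (X.subscheme.presheaf.stalk x)) →
      IsGreatest {π | ∃ η : Y, η ⤳ y ∧ (∃ x : X.subscheme, X.subschemeι x = η ∧
        ¬ IsRegularLocalRing (X.subscheme.presheaf.stalk x)) ∧ π = gen η} (hull y))
    (hhull₁ : ∀ y₁ : Y₁, (∃ x₁ : (X.comap g).subscheme, (X.comap g).subschemeι x₁ = y₁ ∧
        ¬ IsRegularLocalRing ((X.comap g).subscheme.presheaf.stalk x₁)) →
      IsGreatest {π | ∃ η₁ : Y₁, η₁ ⤳ y₁ ∧ (∃ x₁ : (X.comap g).subscheme,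
        (X.comap g).subschemeι x₁ = η₁ ∧
          ¬ IsRegularLocalRing ((X.comap g).subscheme.presheaf.stalk x₁)) ∧ π = gen₁ η₁} (hull₁ y₁))
    (hplex : ∀ y₁ : Y₁, IsClosed ({y₁} : Set Y₁) → (∃ x : X.subscheme, X.subschemeι x = g y₁ ∧
        ¬ IsRegularLocalRing (X.subscheme.presheaf.stalk x)) → plex₁ y₁ = plex (g y₁))
    (y₁ : Y₁) (hy : ∃ x : X.subscheme, X.subschemeι x = g y₁ ∧
      ¬ IsRegularLocalRing (X.subscheme.presheaf.stalk x)) :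
    hull₁ y₁ = hull (g y₁) :=
  genHull_comap_eq_of_smooth f f₁ g hg X hhull hhull₁
    (fun η₁ hη => gen_comap_eq_of_smooth_of_plex f f₁ g hg X hgen hgen₁ hplex η₁ hη) y₁ hy

/-- **(B3') ⇒ `HullBaseChange`, end to end.** Perfect ground-field extension `pr : Y ×_k K → Y`,
`plex₁ y₁ = gen (pr y₁)` at closed singular points ⇒ the hulls agree at all singular points
(`gen_comap_eq_of_isPullback_of_plex` + `genHull_comap_eq_of_isPullback_perfectField`). [folklore] -/
theorem genHull_comap_eq_of_isPullback_of_plex {α : Type w} [PartialOrder α] ⦃k : Type⦄ [Field k]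
    [PerfectField k] ⦃K : Type⦄ [Field K] [PerfectField K] (φ : k →+* K) ⦃Y YK : Scheme.{0}⦄
    (f : Y ⟶ Spec (.of k)) [LocallyOfFiniteType f] (fK : YK ⟶ Spec (.of K)) (pr : YK ⟶ Y)
    (hpb : IsPullback pr fK f (Spec.map (CommRingCat.ofHom φ))) (X : Y.IdealSheafData)
    {plex gen hull : Y → α} {plex₁ gen₁ hull₁ : YK → α}
    (hgen : ∀ η : Y, (∃ x : X.subscheme, X.subschemeι x = η ∧
        ¬ IsRegularLocalRing (X.subscheme.presheaf.stalk x)) →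
      ∃ W : Y.Opens, η ∈ W ∧ ∀ y : Y, y ∈ W → η ⤳ y → IsClosed ({y} : Set Y) → plex y = gen η)
    (hgen₁ : ∀ η₁ : YK, (∃ x₁ : (X.comap pr).subscheme, (X.comap pr).subschemeι x₁ = η₁ ∧
        ¬ IsRegularLocalRing ((X.comap pr).subscheme.presheaf.stalk x₁)) →
      ∃ W₁ : YK.Opens, η₁ ∈ W₁ ∧
        ∀ y₁ : YK, y₁ ∈ W₁ → η₁ ⤳ y₁ → IsClosed ({y₁} : Set YK) → plex₁ y₁ = gen₁ η₁)
    (hhull : ∀ y : Y, (∃ x : X.subscheme, X.subschemeι x = y ∧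
        ¬ IsRegularLocalRing (X.subscheme.presheaf.stalk x)) →
      IsGreatest {π | ∃ η : Y, η ⤳ y ∧ (∃ x : X.subscheme, X.subschemeι x = η ∧
        ¬ IsRegularLocalRing (X.subscheme.presheaf.stalk x)) ∧ π = gen η} (hull y))
    (hhull₁ : ∀ y₁ : YK, (∃ x₁ : (X.comap pr).subscheme, (X.comap pr).subschemeι x₁ = y₁ ∧
        ¬ IsRegularLocalRing ((X.comap pr).subscheme.presheaf.stalk x₁)) →
      IsGreatest {π | ∃ η₁ : YK, η₁ ⤳ y₁ ∧ (∃ x₁ : (X.comap pr).subscheme,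
        (X.comap pr).subschemeι x₁ = η₁ ∧
          ¬ IsRegularLocalRing ((X.comap pr).subscheme.presheaf.stalk x₁)) ∧ π = gen₁ η₁} (hull₁ y₁))
    (hplex : ∀ y₁ : YK, IsClosed ({y₁} : Set YK) → (∃ x : X.subscheme, X.subschemeι x = pr y₁ ∧
        ¬ IsRegularLocalRing (X.subscheme.presheaf.stalk x)) → plex₁ y₁ = gen (pr y₁))
    (y₁ : YK) (hy : ∃ x : X.subscheme, X.subschemeι x = pr y₁ ∧
      ¬ IsRegularLocalRing (X.subscheme.presheaf.stalk x)) :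
    hull₁ y₁ = hull (pr y₁) :=
  genHull_comap_eq_of_isPullback_perfectField φ f fK pr hpb X hhull hhull₁
    (fun η₁ hη => gen_comap_eq_of_isPullback_of_plex φ f fK pr hpb X hgen hgen₁ hplex η₁ hη) y₁ hy

end Summit.ResolutionOfSingularities.ResolutionOfSingularities.Theorems
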